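import Literature.NumberTheory.GelbartRogawski1991.LocalUnitaryUndoublingTransport
import Literature.NumberTheory.GelbartRogawski1991.LocalScaleModelTransportUndoubling
import Literature.NumberTheory.GelbartRogawski1991.LocalMpAddCharRescaling
import HarnessLib

-- buildfix G11b-3 recipe (LEDGER B13-1/B13-3), as in the GelbartRogawski1991 siblings.
set_option Elab.async false

/-!
# Undoubling commutes with the Galois transport: `Ψ (undoubleLoc s₀^𝔻 g) = undoubleLoc s₁^𝔻 (scaleInl g)`

Topic `NumberTheory/GelbartRogawski1991`; namespace `Literature.NumberTheory.GelbartRogawski1991.UnitaryDualPair.LocalSplitting`.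
KERNEL ONLY: theorems; no definition, no named fact, no `sorry`.  Sequel of `LocalUnitaryUndoublingTransport` (operator-level
descent) in the format of `LocalScaleModelTransportUndoubling.scaleTransportSection_undoubleLoc` (the SCALE transport commutes with
undoubling); cell `hodgecm-mathlib`, row III-11a, piece (iv) of the assembler's carve (B-p08 2026-08-28T07:50:30Z).

SETTING.  Gram matrices `T₀` and `T₁ = t • T₀` (`hTT`, with `gramD n T₁ = t • gramD n T₀`, `hDD`), doubled packages `s₀^𝔻`, `s₁^𝔻`
(homomorphisms of `U(Tᵢ ⊕ −Tᵢ)(F_v)` into `S̃p(𝕎^𝔻_v, β_{Tᵢ^𝔻})` over `ι^𝔻_v`), and two TRANSPORTS given ABSTRACTLY (the assembler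
instantiates them with `e ∘ galTwist` at ranks `n + n` and `n`, [B-p14] `exists_galTwist_rescale`, [B-p08] `LocalMp.galTwist`):
* `ΨD` on the doubled groups of pairs and `Ψ` on the undoubled ones, with OPERATOR FORMULAS `ω(ΨD x)(BD F) = BD (ω(x) F)` and
  `ω(Ψ x)(B f) = B (ω(x) f)` for maps `BD`, `B` of the Schwartz–Bruhat models which are BOX-COMPATIBLE on one pair of test vectors
  (`BD (f₁ ⊠ f₂) = B f₁ ⊠ f₂'`, `f₂' ≠ 0`), `B` onto, and `Ψ` over the identity on linear maps of `𝕎_v` (`hΨproj`);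
* the DOUBLED SECTION IDENTITY `ΨD (s₀^𝔻 h) = s₁^𝔻 (scaleInl h)` on `U(T₀ ⊕ −T₀)(F_v)` (Kudla rigidity,
  `LocalSplittingCMGaloisTransportRigidity` / `LocalSplittingCMGaloisTransport` for the CM packages).
CONCLUSION (`apply_undoubleLoc_eq_undoubleLoc_scaleInl_of_transport`): for every `g ∈ U(T₀)(F_v)`,

  `Ψ (undoubleLoc s₀^𝔻 g) = undoubleLoc s₁^𝔻 (scaleInl g)`   in `S̃p(𝕎_v, β_{T₁})`

— equal projections (`proj_undoubleLoc` + `coe_iota_scaleInl`: `ι^{T₁}(scaleInl g) = ι^{T₀}(g)` on `𝕎_v`) and equal operators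
(`LocalUnitaryUndoublingTransport.apply_toRep_undoubleLoc_eq_of_box_transport` fed with the doubled identity at `h = g ⊕ 1`,
`inlLoc_scaleInl`), so `MpPsi.ext_of_proj_of_toRep`.  The instance `BD := D_s ∘ (τ ∘ ·)` on `𝒮(F_v^{n+n})`, `B := D_s ∘ (τ ∘ ·)` on
`𝒮(F_vⁿ)` (box-compatible, `galDilation_boxSB`; onto for an automorphism `τ`) is `galDilation_apply_undoubleLoc_eq_undoubleLoc_scaleInl`.
HC_CM is proved only modulo the 7 printed citations until rung 0 of the ladder closes; nothing about it is claimed here.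

## References
* [MoeglinVignerasWaldspurger1987] C. Mœglin, M.-F. Vignéras, J.-L. Waldspurger, LNM 1291 (1987), Chap. 2 II.1 (B) and Rem. (6).
* [GelbartRogawski1991] S. Gelbart, J. Rogawski, Invent. Math. 105 (1991), §3.1 Prop. 3.1.1 p. 455 L1–3.
* [Liu2021] Y. Liu, Camb. J. Math. 9 (2021), Thm. 4.18 (3), proof l. 2272–2289.
-/

set_option autoImplicit false

noncomputable section

open NumberField IsDedekindDomain Matrix
open Literature.RepresentationTheory.HeisenbergGroup
open Literature.NumberTheory.Automorphic Literature.NumberTheory.Weil1964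

namespace Literature.NumberTheory.GelbartRogawski1991.UnitaryDualPair.LocalSplitting

variable (F : Type) [Field F] [NumberField F] (E : Type) [Field E] [NumberField E] [Algebra F E] (c : E ≃ₐ[F] E)
  (v : HeightOneSpectrum (𝓞 F)) (n : ℕ)
  {T₀ T₁ : Matrix (Fin n) (Fin n) F} (hT₀ : T₀.IsSymm) (hT₀d : IsUnit T₀.det) (hT₁ : T₁.IsSymm) (hT₁d : IsUnit T₁.det)
  (t : Fˣ) (hTT : T₁ = (t : F) • T₀) (hDD : gramD F n T₁ = (t : F) • gramD F n T₀)
  {J₀ J₁ : Matrix (Fin n) (Fin n) E} (hJ₀ : J₀ = T₀.map (algebraMap F E)) (hJ₁ : J₁ = T₁.map (algebraMap F E))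
  {JD₀ JD₁ : Matrix (Fin (n + n)) (Fin (n + n)) E} (hJD₀ : JD₀ = (gramD F n T₀).map (algebraMap F E))
  (hJD₁ : JD₁ = (gramD F n T₁).map (algebraMap F E))
  [Algebra.IsQuadraticExtension F E] {δ : E} (hcδ : c δ = -δ) (hδ : δ ≠ 0) {d : F} (hd : δ * δ = algebraMap F E d)
  (s₀ : UnitaryGroup.localPi E c (n + n) JD₀ v →* LocalMp F (n + n) (gramD F n T₀) v)
  (hs₀ : ∀ g, MpPsi.proj _ (s₀ g) = iota F E c (n + n) hcδ hδ hd (gramD F n T₀) (gramD_isSymm F n hT₀) hJD₀ v g)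
  (s₁ : UnitaryGroup.localPi E c (n + n) JD₁ v →* LocalMp F (n + n) (gramD F n T₁) v)
  (hs₁ : ∀ g, MpPsi.proj _ (s₁ g) = iota F E c (n + n) hcδ hδ hd (gramD F n T₁) (gramD_isSymm F n hT₁) hJD₁ v g)

set_option maxHeartbeats 400000 in
/-- **UNDOUBLING COMMUTES WITH A BOX-COMPATIBLE TRANSPORT (abstract form).**  Transports `ΨD` (doubled) and `Ψ` (undoubled) with
operator formulas through box-compatible `BD`, `B` (`B` onto), `Ψ` over the identity on linear maps of `𝕎_v`, and the doubled section
identity `ΨD (s₀^𝔻 h) = s₁^𝔻 (scaleInl h)` give `Ψ (undoubleLoc s₀^𝔻 g) = undoubleLoc s₁^𝔻 (scaleInl g)` for every `g ∈ U(T₀)(F_v)`.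
[cite: MoeglinVignerasWaldspurger1987, Chap. 2 II.1 (B) and Rem. (6)] [cite: GelbartRogawski1991, §3.1 Prop. 3.1.1 p. 455 L1–3] -/
theorem apply_undoubleLoc_eq_undoubleLoc_scaleInl_of_transport
    (ΨD : LocalMp F (n + n) (gramD F n T₀) v → LocalMp F (n + n) (gramD F n T₁) v)
    (Ψ : LocalMp F n T₀ v → LocalMp F n T₁ v)
    (B : SchwartzBruhat (Fin n → v.adicCompletion F) → SchwartzBruhat (Fin n → v.adicCompletion F))
    (hBsurj : Function.Surjective B)
    (BD : SchwartzBruhat (Fin (n + n) → v.adicCompletion F) → SchwartzBruhat (Fin (n + n) → v.adicCompletion F))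
    (f₂ f₂' : SchwartzBruhat (Fin n → v.adicCompletion F)) (hf₂' : f₂' ≠ 0)
    (hbox : ∀ f₁ : SchwartzBruhat (Fin n → v.adicCompletion F),
      BD (boxSB (v.adicCompletion F) (e₂ n) f₁ f₂) = boxSB (v.adicCompletion F) (e₂ n) (B f₁) f₂')
    (hΨDop : ∀ (x : LocalMp F (n + n) (gramD F n T₀) v) (Φ : SchwartzBruhat (Fin (n + n) → v.adicCompletion F)),
      MpPsi.toRep (localSchrodinger F (n + n) (gramD F n T₁) v) (ΨD x) (BD Φ) =
        BD (MpPsi.toRep (localSchrodinger F (n + n) (gramD F n T₀) v) x Φ))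
    (hΨop : ∀ (x : LocalMp F n T₀ v) (f : SchwartzBruhat (Fin n → v.adicCompletion F)),
      MpPsi.toRep (localSchrodinger F n T₁ v) (Ψ x) (B f) = B (MpPsi.toRep (localSchrodinger F n T₀ v) x f))
    (hΨproj : ∀ x : LocalMp F n T₀ v,
      ((MpPsi.proj _ (Ψ x) : LocalSp F n T₁ v) :
          ((Fin n → v.adicCompletion F) × (Fin n → v.adicCompletion F)) ≃ₗ[v.adicCompletion F]
            ((Fin n → v.adicCompletion F) × (Fin n → v.adicCompletion F))) =
        (MpPsi.proj _ x : LocalSp F n T₀ v))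
    (hsec : ∀ h : UnitaryGroup.localPi E c (n + n) JD₀ v,
      ΨD (s₀ h) = s₁ (scaleInl F E c (n + n) (gramD F n T₀) (gramD F n T₁) t hDD hJD₀ hJD₁ v h))
    (g : UnitaryGroup.localPi E c n J₀ v) :
    Ψ (undoubleLoc F E c v n hJ₀ hJD₀ hcδ hδ hd hT₀ hT₀d s₀ hs₀ g) =
      undoubleLoc F E c v n hJ₁ hJD₁ hcδ hδ hd hT₁ hT₁d s₁ hs₁ (scaleInl F E c n T₀ T₁ t hTT hJ₀ hJ₁ v g) := by
  refine MpPsi.ext_of_proj_of_toRep ?_ fun f => ?_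
  · -- projections: `Ψ` is over the identity, both undoublings are over `ι`, and `ι^{T₁}(scaleInl g) = ι^{T₀}(g)` on `𝕎_v`
    apply Subtype.ext
    rw [hΨproj, proj_undoubleLoc, proj_undoubleLoc, coe_iota_scaleInl]
  · -- operators: descend the doubled identity read at `h = g ⊕ 1` through the box-compatible pair `(BD, B)`
    obtain ⟨f₁, rfl⟩ := hBsurj f
    rw [hΨop]
    refine apply_toRep_undoubleLoc_eq_of_box_transport F E c v n hJ₀ hJD₀ hJ₁ hJD₁ hcδ hδ hd hT₀ hT₀d hT₁ hT₁d s₀ hs₀ s₁ hs₁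
      B BD f₂ f₂' hf₂' hbox g _ (fun f₁' => ?_) f₁
    -- (hygiene: an explicit chain, no `rw` across the two doubled models)
    have h1 := hΨDop (s₀ (inlLoc F E c v n hJ₀ hJD₀ g)) (boxSB (v.adicCompletion F) (e₂ n) f₁' f₂)
    have h2 := hsec (inlLoc F E c v n hJ₀ hJD₀ g)
    have h3 := inlLoc_scaleInl F E c t v hTT hDD hJ₀ hJ₁ hJD₀ hJD₁ g
    exact h1.symm.trans (congrArg (fun y => MpPsi.toRep (localSchrodinger F (n + n) (gramD F n T₁) v) y
      (BD (boxSB (v.adicCompletion F) (e₂ n) f₁' f₂))) (h2.trans (congrArg s₁ h3.symm)))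

/-- **UNDOUBLING COMMUTES WITH THE GALOIS TRANSPORT `B = D_s ∘ (τ ∘ ·)`** (the road's instance: `τ = σ` an automorphism of `ℂ` given with
its inverse `τ'`, `s ∈ F_vˣ` the dilation unit): if `ΨD`, `Ψ` have the operator formulas `ω(ΨD x)(D_s(τ ∘ F)) = D_s(τ ∘ ω(x)F)`,
`ω(Ψ x)(D_s(τ ∘ f)) = D_s(τ ∘ ω(x) f)`, `Ψ` is over the identity of `𝕎_v`, and `ΨD ∘ s₀^𝔻 = s₁^𝔻 ∘ scaleInl`, then
`Ψ (undoubleLoc s₀^𝔻 g) = undoubleLoc s₁^𝔻 (scaleInl g)`. [cite: MoeglinVignerasWaldspurger1987, Chap. 2 II.1 (B) and Rem. (6)]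
[cite: Liu2021, Thm. 4.18 (3), proof l. 2272–2289] -/
theorem galDilation_apply_undoubleLoc_eq_undoubleLoc_scaleInl (τ τ' : ℂ →+* ℂ) (hττ' : ∀ z, τ (τ' z) = z)
    (s : (v.adicCompletion F)ˣ)
    (ΨD : LocalMp F (n + n) (gramD F n T₀) v → LocalMp F (n + n) (gramD F n T₁) v)
    (Ψ : LocalMp F n T₀ v → LocalMp F n T₁ v)
    (hΨDop : ∀ (x : LocalMp F (n + n) (gramD F n T₀) v) (Φ : SchwartzBruhat (Fin (n + n) → v.adicCompletion F)),
      MpPsi.toRep (localSchrodinger F (n + n) (gramD F n T₁) v) (ΨD x)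
          (leviEquivSB (LinearEquiv.smulOfUnit s : (Fin (n + n) → v.adicCompletion F) ≃ₗ[v.adicCompletion F]
              (Fin (n + n) → v.adicCompletion F)) (continuous_const_smul (s : v.adicCompletion F))
            (continuous_const_smul ((s⁻¹ : (v.adicCompletion F)ˣ) : v.adicCompletion F)) (schwartzGalConj τ Φ)) =
        leviEquivSB (LinearEquiv.smulOfUnit s : (Fin (n + n) → v.adicCompletion F) ≃ₗ[v.adicCompletion F]
            (Fin (n + n) → v.adicCompletion F)) (continuous_const_smul (s : v.adicCompletion F))
          (continuous_const_smul ((s⁻¹ : (v.adicCompletion F)ˣ) : v.adicCompletion F))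
          (schwartzGalConj τ (MpPsi.toRep (localSchrodinger F (n + n) (gramD F n T₀) v) x Φ)))
    (hΨop : ∀ (x : LocalMp F n T₀ v) (f : SchwartzBruhat (Fin n → v.adicCompletion F)),
      MpPsi.toRep (localSchrodinger F n T₁ v) (Ψ x)
          (leviEquivSB (LinearEquiv.smulOfUnit s : (Fin n → v.adicCompletion F) ≃ₗ[v.adicCompletion F]
              (Fin n → v.adicCompletion F)) (continuous_const_smul (s : v.adicCompletion F))
            (continuous_const_smul ((s⁻¹ : (v.adicCompletion F)ˣ) : v.adicCompletion F)) (schwartzGalConj τ f)) =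
        leviEquivSB (LinearEquiv.smulOfUnit s : (Fin n → v.adicCompletion F) ≃ₗ[v.adicCompletion F]
            (Fin n → v.adicCompletion F)) (continuous_const_smul (s : v.adicCompletion F))
          (continuous_const_smul ((s⁻¹ : (v.adicCompletion F)ˣ) : v.adicCompletion F))
          (schwartzGalConj τ (MpPsi.toRep (localSchrodinger F n T₀ v) x f)))
    (hΨproj : ∀ x : LocalMp F n T₀ v,
      ((MpPsi.proj _ (Ψ x) : LocalSp F n T₁ v) :
          ((Fin n → v.adicCompletion F) × (Fin n → v.adicCompletion F)) ≃ₗ[v.adicCompletion F]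
            ((Fin n → v.adicCompletion F) × (Fin n → v.adicCompletion F))) =
        (MpPsi.proj _ x : LocalSp F n T₀ v))
    (hsec : ∀ h : UnitaryGroup.localPi E c (n + n) JD₀ v,
      ΨD (s₀ h) = s₁ (scaleInl F E c (n + n) (gramD F n T₀) (gramD F n T₁) t hDD hJD₀ hJD₁ v h))
    (g : UnitaryGroup.localPi E c n J₀ v) :
    Ψ (undoubleLoc F E c v n hJ₀ hJD₀ hcδ hδ hd hT₀ hT₀d s₀ hs₀ g) =
      undoubleLoc F E c v n hJ₁ hJD₁ hcδ hδ hd hT₁ hT₁d s₁ hs₁ (scaleInl F E c n T₀ T₁ t hTT hJ₀ hJ₁ v g) := by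
  obtain ⟨f₂, hf₂⟩ := exists_schwartzBruhat_pi_ne_zero (v.adicCompletion F) (Fin n)
  have hBsurj : Function.Surjective fun f : SchwartzBruhat (Fin n → v.adicCompletion F) =>
      leviEquivSB (LinearEquiv.smulOfUnit s : (Fin n → v.adicCompletion F) ≃ₗ[v.adicCompletion F]
          (Fin n → v.adicCompletion F)) (continuous_const_smul (s : v.adicCompletion F))
        (continuous_const_smul ((s⁻¹ : (v.adicCompletion F)ˣ) : v.adicCompletion F)) (schwartzGalConj τ f) :=
    (LinearEquiv.surjective _).comp (schwartzGalConj_bijective τ τ' hττ').2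
  exact apply_undoubleLoc_eq_undoubleLoc_scaleInl_of_transport F E c v n hT₀ hT₀d hT₁ hT₁d t hTT hDD hJ₀ hJ₁ hJD₀ hJD₁ hcδ hδ hd
    s₀ hs₀ s₁ hs₁ ΨD Ψ _ hBsurj _ f₂ _ (galDilation_ne_zero (v.adicCompletion F) τ s hf₂)
    (fun f₁ => galDilation_boxSB (v.adicCompletion F) (e := e₂ n) τ s f₁ f₂) hΨDop hΨop hΨproj hsec g

end Literature.NumberTheory.GelbartRogawski1991.UnitaryDualPair.LocalSplitting

end
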